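import Literature.RingTheory.DedekindDomain.PrincipalUnitPowerLevel
import HarnessLib

/-!
# Levels of units at a prime with residue field `𝔽₂`: every `x ∉ 𝔭` is `≡ 1 mod 𝔭` (level `ℓ ≥ 1`), and `x² ≡ 1 mod 𝔭²` (level `≥ 2`)

Serre, *A Course in Arithmetic* (1973), Ch. II §3.1 / §3.3 (`U = U₁` and `U₁² ⊆ U₂` in `ℤ₂`; here the part that holds at ANY prime `𝔭` of a
Dedekind domain with `#R/𝔭 = 2`).  These supply the binders `hℓ / hαℓ / ha2 / hαa` of the two-variable (c)-capstone tower
(`RayClassFieldTwoVariableTowerData[Offset]`) at an auxiliary prime `v' ∣ 2` of DEGREE ONE, for every `α ∉ v'` with `α ≠ 1`, `α² ≠ 1`: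

* `eq_zero_or_eq_one_of_card_quotient_eq_two`, `mem_of_not_mem_of_card_quotient_eq_two` (`#R/𝔭 = 2`, `x ∉ 𝔭` ⟹ `x − 1 ∈ 𝔭`),
  `two_mem_of_card_quotient_eq_two` (`2 ∈ 𝔭`);
* `exists_intValuation_eq_exp_neg_of_mem_pow` — a non-zero `r ∈ 𝔭^n` has `v(r) = exp(−m)` for some `m ≥ n`;
* ★ `exists_level_of_not_mem` — `x ∉ 𝔭`, `x ≠ 1` ⟹ `∃ ℓ ≥ 1, v(x − 1) = exp(−ℓ)`;
* ★ `exists_level_sq_of_not_mem` — `x ∉ 𝔭`, `x² ≠ 1` ⟹ `∃ m ≥ 2, v(x² − 1) = exp(−m)` (`x² − 1 = (x − 1)(x + 1)`, both factors in `𝔭`).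

Cell `bsd-print-cf2`, width seat `bsd-line-cf2c-w7` g17.  Theorems only; no `sorry`; no definitions.

## References
* [Serre1973CourseArithmetic] J.-P. Serre, *A Course in Arithmetic* (1973), Ch. II §3.1, §3.3.
* [deShalit1987] E. de Shalit, *Iwasawa theory of elliptic curves with complex multiplication* (1987), II.4.17 (p. 78).
-/

noncomputable section

open IsDedekindDomain IsDedekindDomain.HeightOneSpectrum WithZero
open scoped Classical

namespace Literature.RingTheory.DedekindDomain

variable {R : Type*} [CommRing R] [IsDedekindDomain R] (v : HeightOneSpectrum R)

omit [IsDedekindDomain R] in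
/-- In `R/𝔭` with `#R/𝔭 = 2` every element is `0` or `1`. [cite: Serre1973CourseArithmetic, Ch. II §3.3] -/
theorem eq_zero_or_eq_one_of_card_quotient_eq_two (h2 : Nat.card (R ⧸ v.asIdeal) = 2) (y : R ⧸ v.asIdeal) : y = 0 ∨ y = 1 := by
  have h01 : (0 : R ⧸ v.asIdeal) ≠ 1 := by
    intro h
    have : (1 : R) ∈ v.asIdeal := by
      rw [← Ideal.Quotient.eq_zero_iff_mem, map_one]; exact h.symm
    exact v.isPrime.ne_top ((Ideal.eq_top_iff_one _).mpr this)
  obtain ⟨a, b, hab, huniv⟩ := Nat.card_eq_two_iff.mp h2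
  have hmem : ∀ z : R ⧸ v.asIdeal, z = a ∨ z = b := fun z ↦ by
    have hz : z ∈ ({a, b} : Set (R ⧸ v.asIdeal)) := by rw [huniv]; exact Set.mem_univ z
    simpa only [Set.mem_insert_iff, Set.mem_singleton_iff] using hz
  rcases hmem 0 with h0 | h0 <;> rcases hmem 1 with h1 | h1
  · exact absurd (h0.trans h1.symm) h01
  · rcases hmem y with hy | hy
    · exact Or.inl (hy.trans h0.symm)
    · exact Or.inr (hy.trans h1.symm)
  · rcases hmem y with hy | hy
    · exact Or.inr (hy.trans h1.symm)
    · exact Or.inl (hy.trans h0.symm)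
  · exact absurd (h0.trans h1.symm) h01

omit [IsDedekindDomain R] in
/-- **`#R/𝔭 = 2`, `x ∉ 𝔭` ⟹ `x ≡ 1 mod 𝔭`.** [cite: Serre1973CourseArithmetic, Ch. II §3.3] -/
theorem mem_of_not_mem_of_card_quotient_eq_two (h2 : Nat.card (R ⧸ v.asIdeal) = 2) {x : R} (hx : x ∉ v.asIdeal) :
    x - 1 ∈ v.asIdeal := by
  rw [← Ideal.Quotient.eq, map_one]
  rcases eq_zero_or_eq_one_of_card_quotient_eq_two v h2 (Ideal.Quotient.mk v.asIdeal x) with h | h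
  · exact absurd (Ideal.Quotient.eq_zero_iff_mem.mp h) hx
  · exact h

omit [IsDedekindDomain R] in
/-- **`#R/𝔭 = 2 ⟹ 2 ∈ 𝔭`** (the residue field has characteristic `2`). [cite: Serre1973CourseArithmetic, Ch. II §3.3] -/
theorem two_mem_of_card_quotient_eq_two (h2 : Nat.card (R ⧸ v.asIdeal) = 2) : (2 : R) ∈ v.asIdeal := by
  rw [← Ideal.Quotient.eq_zero_iff_mem, map_ofNat]
  rcases eq_zero_or_eq_one_of_card_quotient_eq_two v h2 2 with h | h
  · exact h
  · exfalso
    have h1 : (1 : R ⧸ v.asIdeal) = 0 := by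
      have e : (2 : R ⧸ v.asIdeal) = 1 + 1 := by norm_num
      rw [e] at h
      exact add_eq_left.mp h
    have : (1 : R) ∈ v.asIdeal := by
      rw [← Ideal.Quotient.eq_zero_iff_mem, map_one]; exact h1
    exact v.isPrime.ne_top ((Ideal.eq_top_iff_one _).mpr this)

/-- A non-zero `r ∈ 𝔭^n` has `v(r) = exp(−m)` for some `m ≥ n`. [cite: Serre1973CourseArithmetic, Ch. II §3.1] -/
theorem exists_intValuation_eq_exp_neg_of_mem_pow {r : R} (hr0 : r ≠ 0) {n : ℕ} (hr : r ∈ v.asIdeal ^ n) :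
    ∃ m : ℕ, n ≤ m ∧ v.intValuation r = exp (-(m : ℤ)) := by
  obtain ⟨a, ha⟩ : ∃ a : ℤ, v.intValuation r = exp a :=
    ⟨log (v.intValuation r), (exp_log (v.intValuation_ne_zero r hr0)).symm⟩
  have hle : v.intValuation r ≤ exp (-(n : ℤ)) := (intValuation_le_pow_iff_mem v r n).mpr hr
  rw [ha, exp_le_exp] at hle
  refine ⟨(-a).toNat, by omega, ?_⟩
  rw [ha, exp_inj]
  omega

/-- ★ **`x ∉ 𝔭`, `x ≠ 1`, `#R/𝔭 = 2` ⟹ `x` has a level `ℓ ≥ 1`: `v(x − 1) = exp(−ℓ)`.** [cite: Serre1973CourseArithmetic, Ch. II §3.3] -/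
theorem exists_level_of_not_mem (h2 : Nat.card (R ⧸ v.asIdeal) = 2) {x : R} (hx : x ∉ v.asIdeal) (hx1 : x ≠ 1) :
    ∃ ℓ : ℕ, 1 ≤ ℓ ∧ v.intValuation (x - 1) = exp (-(ℓ : ℤ)) :=
  exists_intValuation_eq_exp_neg_of_mem_pow v (sub_ne_zero.mpr hx1) (n := 1)
    (by rw [pow_one]; exact mem_of_not_mem_of_card_quotient_eq_two v h2 hx)

/-- ★ **`x ∉ 𝔭`, `x² ≠ 1`, `#R/𝔭 = 2` ⟹ `v(x² − 1) = exp(−m)` with `m ≥ 2`** (`x² − 1 = (x − 1)(x + 1)` and both `x − 1`, `x + 1 = (x − 1) + 2`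
lie in `𝔭`). [cite: Serre1973CourseArithmetic, Ch. II §3.3] [cite: deShalit1987, II.4.17 (p. 78)] -/
theorem exists_level_sq_of_not_mem (h2 : Nat.card (R ⧸ v.asIdeal) = 2) {x : R} (hx : x ∉ v.asIdeal) (hx2 : x ^ 2 ≠ 1) :
    ∃ m : ℕ, 2 ≤ m ∧ v.intValuation (x ^ 2 - 1) = exp (-(m : ℤ)) := by
  have h1 : x - 1 ∈ v.asIdeal := mem_of_not_mem_of_card_quotient_eq_two v h2 hx
  have h1' : x + 1 ∈ v.asIdeal := by
    have e : x + 1 = (x - 1) + 2 := by ring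
    rw [e]
    exact v.asIdeal.add_mem h1 (two_mem_of_card_quotient_eq_two v h2)
  refine exists_intValuation_eq_exp_neg_of_mem_pow v (sub_ne_zero.mpr hx2) (n := 2) ?_
  have e : x ^ 2 - 1 = (x - 1) * (x + 1) := by ring
  rw [e, pow_two]
  exact Ideal.mul_mem_mul h1 h1'

end Literature.RingTheory.DedekindDomain

end
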